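import Mathlib
import Literature.NumberTheory.LFunctions.WeilOddGroundState
import Summits.RiemannHypothesis.RiemannHypothesis.Theorems.WeilParityEvenWinsBeyondArchFrontier75OfOddLower
import Summits.RiemannHypothesis.RiemannHypothesis.Theorems.GroundBartaEvenWinsBeyondArchUpper77
import Summits.RiemannHypothesis.RiemannHypothesis.Theorems.WeilGroundStateGroundStateSimpleEvenCellTransfer
import HarnessLib

/-!
# The parity ladder beyond `log 2`: the cell `[77/100, 39/50]` from an odd-sector lower bound at `39/50`

Route WeilParity item `NoParityCrossing` (stmt-RiemannHypothesis-18085) ≡ GroundBarta rung 4 (stmt-RiemannHypothesis-18807).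
Pure logic, RH-free.  Prover A (gen 2).  With the landed U-side `trialUpper77 : ε(77/100) ≤ 1/(32·10¹²)` the cell transfer
reduces the fourth cell to `1/(32·10¹²) < L ≤ ε_od(39/50)`; chained with the first three L-sides: `WeilWindowSimpleEven` on
`(0, 39/50]`.
-/

set_option linter.dupNamespace false

noncomputable section

open Set MeasureTheory

namespace Summit.RiemannHypothesis.RiemannHypothesis.Theorems.EvenWinsBeyondArch

open Literature.NumberTheory.LFunctions

/-- **The cell `[77/100, 39/50]`**: `1/(32·10¹²) < L ≤ ε_od(39/50) ⟹ WeilWindowSimpleEven a` for `a ∈ [77/100, 39/50]`. [folklore] -/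
theorem weilWindowSimpleEven_on_cell_M78_of_oddLower {L : ℝ} (hUL : (1 / 32000000000000 : ℝ) < L)
    (hL : L ≤ weilOddGroundEnergy (39 / 50 : ℝ)) {a : ℝ} (hlo : (77 / 100 : ℝ) ≤ a) (hhi : a ≤ 39 / 50) :
    WeilWindowSimpleEven a :=
  GroundStateSimpleEven.weilWindowSimpleEven_on_cell_of_le (b := (77 / 100 : ℝ)) (c := (39 / 50 : ℝ)) (by norm_num) hUL
    trialUpper77 (fun _ hg hs hn ho ↦ hL.trans (weilOddGroundEnergy_le hg hs ho hn)) hlo hhi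

/-- **`WeilWindowSimpleEven` on `(0, 39/50]`** from the four odd-sector lower bounds. [folklore] -/
theorem weilWindowSimpleEven_of_le_M78_of_oddLower {L₁ L₂ L₃ L₄ : ℝ} (hUL₁ : (1 / 100000000000 : ℝ) < L₁)
    (hL₁ : L₁ ≤ weilOddGroundEnergy (18 / 25 : ℝ)) (hUL₂ : (1 / 8000000000000 : ℝ) < L₂)
    (hL₂ : L₂ ≤ weilOddGroundEnergy (3 / 4 : ℝ)) (hUL₃ : (1 / 14000000000000 : ℝ) < L₃)
    (hL₃ : L₃ ≤ weilOddGroundEnergy (77 / 100 : ℝ)) (hUL₄ : (1 / 32000000000000 : ℝ) < L₄)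
    (hL₄ : L₄ ≤ weilOddGroundEnergy (39 / 50 : ℝ)) :
    ∀ a : ℝ, 0 < a → a ≤ 39 / 50 → WeilWindowSimpleEven a := by
  intro a ha hle
  rcases le_or_gt a (77 / 100) with h | h
  · exact weilWindowSimpleEven_of_le_M77_of_oddLower hUL₁ hL₁ hUL₂ hL₂ hUL₃ hL₃ a ha h
  · exact weilWindowSimpleEven_on_cell_M78_of_oddLower hUL₄ hL₄ h.le hle

end Summit.RiemannHypothesis.RiemannHypothesis.Theorems.EvenWinsBeyondArch

end
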